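import Mathlib

/-!
# The `a_bound` of a dominant-term argument from two one-place decays in the invariant (support, seat p1)

The shadow `DominantSide` (`T7SupportDominantGeometricSide`) asks for ONE polynomial decay of the archimedean
factor in ONE size, `‖a γ‖ ≤ C (1 + size γ)^{−α}`, while the model rows give a decay at EACH rank-one place
in that place's invariant, `‖a_v γ‖ ≤ C_v κ_v(γ)^{−α}` with `κ_v ≥ 1` (`T7SupportBergmanOrbitalDecay`,
`α = k/2`), and the count is taken in the product size `size γ = (1 + |κ₂(γ) − κ₀|)(1 + |κ₃(γ) − κ₀|)`
(t7-L1-p5's `count_bound` glue, STATUS l. 15039). This file is the conversion: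

* `one_add_abs_sub_le`: `1 + |κ − κ₀| ≤ (2 + |κ₀|) κ` for `κ ≥ 1`;
* `rpow_neg_mul_rpow_neg_le`: `x^{−α} y^{−α} ≤ (2M)^α (1 + s)^{−α}` whenever `s ≤ M x y` (`x, y, M ≥ 1`);
* **`a_bound_of_two_places`**: from `‖a₂ γ‖ ≤ C₂ κ₂(γ)^{−α}` and `‖a₃ γ‖ ≤ C₃ κ₃(γ)^{−α}` (`κ_v ≥ 1`, `α ≥ 0`)
  follows `∃ C, ∀ γ, ‖a₂ γ · a₃ γ‖ ≤ C (1 + (1 + |κ₂ γ − κ₀|)(1 + |κ₃ γ − κ₀|))^{−α}` — exactly the `a_bound`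
  field for the product size, with `C = |C₂| |C₃| (2 (2 + |κ₀|)²)^α`;
* `a_bound_of_bounded_mul`: a bounded factor (the compact place) does not change the shape.

Nothing here is about any group or any period; the identification of the model invariants with the real
double-coset invariants stays with the line.
Blind lane: Mathlib only; no sorry; axioms ⊆ {propext, Classical.choice, Quot.sound}.
-/

namespace Summit.Ventures.HodgeRepro2.T7SupportArchDecayGlue

/-- `1 + |κ − κ₀| ≤ (2 + |κ₀|) κ` for `κ ≥ 1` -/
theorem one_add_abs_sub_le {κ : ℝ} (hκ : 1 ≤ κ) (κ₀ : ℝ) : 1 + |κ - κ₀| ≤ (2 + |κ₀|) * κ := by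
  have h1 : |κ - κ₀| ≤ |κ| + |κ₀| := abs_sub κ κ₀
  have h2 : |κ| = κ := abs_of_pos (by linarith)
  have h3 : 0 ≤ |κ₀| := abs_nonneg κ₀
  nlinarith

/-- `x^{−α} y^{−α} ≤ (2M)^α (1 + s)^{−α}` when `s ≤ M x y` (`x, y, M ≥ 1`, `s ≥ 0`, `α ≥ 0`) -/
theorem rpow_neg_mul_rpow_neg_le {x y M s α : ℝ} (hx : 1 ≤ x) (hy : 1 ≤ y) (hM : 1 ≤ M) (hs : 0 ≤ s)
    (hsM : s ≤ M * (x * y)) (hα : 0 ≤ α) :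
    x ^ (-α) * y ^ (-α) ≤ (2 * M) ^ α * (1 + s) ^ (-α) := by
  have hx0 : 0 < x := by linarith
  have hy0 : 0 < y := by linarith
  have hM0 : 0 < M := by linarith
  have h1s : 0 < 1 + s := by linarith
  have hxy : 1 ≤ x * y := one_le_mul_of_one_le_of_one_le hx hy
  have hMxy : 1 ≤ M * (x * y) := one_le_mul_of_one_le_of_one_le hM hxy
  -- `1 + s ≤ 2 M x y`
  have hle : 1 + s ≤ 2 * M * (x * y) := by nlinarith
  -- `(1 + s)^α ≤ (2M)^α x^α y^α`
  have h : (1 + s) ^ α ≤ (2 * M) ^ α * (x ^ α * y ^ α) := by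
    rw [← Real.mul_rpow hx0.le hy0.le, ← Real.mul_rpow (by positivity) (by positivity)]
    exact Real.rpow_le_rpow h1s.le (by linarith) hα
  rw [Real.rpow_neg hx0.le, Real.rpow_neg hy0.le, Real.rpow_neg h1s.le]
  have hxα : 0 < x ^ α := Real.rpow_pos_of_pos hx0 α
  have hyα : 0 < y ^ α := Real.rpow_pos_of_pos hy0 α
  have h1α : 0 < (1 + s) ^ α := Real.rpow_pos_of_pos h1s α
  have h2M : 0 < (2 * M) ^ α := Real.rpow_pos_of_pos (by positivity) α
  rw [← mul_inv, ← div_eq_mul_inv, inv_eq_one_div, div_le_div_iff₀ (by positivity) h1α, one_mul]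
  exact h

/-- **the `a_bound` of the product size from two one-place decays in the invariants**: with `κ_v ≥ 1`,
`‖a_v γ‖ ≤ C_v κ_v(γ)^{−α}` (`v = 2, 3`) and `α ≥ 0`,
`‖a₂ γ · a₃ γ‖ ≤ C (1 + (1 + |κ₂ γ − κ₀|)(1 + |κ₃ γ − κ₀|))^{−α}` for `C = |C₂| |C₃| (2 (2 + |κ₀|)²)^α`. -/
theorem a_bound_of_two_places {Orb : Type*} (a₂ a₃ : Orb → ℂ) (κ₂ κ₃ : Orb → ℝ) (hκ₂ : ∀ γ, 1 ≤ κ₂ γ)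
    (hκ₃ : ∀ γ, 1 ≤ κ₃ γ) {α : ℝ} (hα : 0 ≤ α) {C₂ C₃ : ℝ} (h₂ : ∀ γ, ‖a₂ γ‖ ≤ C₂ * κ₂ γ ^ (-α))
    (h₃ : ∀ γ, ‖a₃ γ‖ ≤ C₃ * κ₃ γ ^ (-α)) (κ₀ : ℝ) :
    ∃ C : ℝ, ∀ γ, ‖a₂ γ * a₃ γ‖ ≤ C * (1 + (1 + |κ₂ γ - κ₀|) * (1 + |κ₃ γ - κ₀|)) ^ (-α) := by
  set M : ℝ := 2 + |κ₀| with hMdef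
  have hM1 : 1 ≤ M := by
    have := abs_nonneg κ₀
    rw [hMdef]
    linarith
  have hMsq : 1 ≤ M ^ 2 := one_le_pow₀ hM1
  refine ⟨|C₂| * |C₃| * (2 * M ^ 2) ^ α, fun γ => ?_⟩
  have hx := hκ₂ γ
  have hy := hκ₃ γ
  have hxα : 0 ≤ κ₂ γ ^ (-α) := Real.rpow_nonneg (by linarith) _
  have hyα : 0 ≤ κ₃ γ ^ (-α) := Real.rpow_nonneg (by linarith) _
  -- the size is at most `M² κ₂ κ₃`
  have hsize : (1 + |κ₂ γ - κ₀|) * (1 + |κ₃ γ - κ₀|) ≤ M ^ 2 * (κ₂ γ * κ₃ γ) := by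
    have e2 := one_add_abs_sub_le hx κ₀
    have e3 := one_add_abs_sub_le hy κ₀
    have p2 : 0 ≤ 1 + |κ₂ γ - κ₀| := by positivity
    have p3 : 0 ≤ 1 + |κ₃ γ - κ₀| := by positivity
    calc (1 + |κ₂ γ - κ₀|) * (1 + |κ₃ γ - κ₀|) ≤ (M * κ₂ γ) * (M * κ₃ γ) :=
          mul_le_mul e2 e3 p3 (by positivity)
      _ = M ^ 2 * (κ₂ γ * κ₃ γ) := by ring
  have hs0 : 0 ≤ (1 + |κ₂ γ - κ₀|) * (1 + |κ₃ γ - κ₀|) := by positivity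
  have hkey := rpow_neg_mul_rpow_neg_le hx hy hMsq hs0 hsize hα
  -- assemble
  calc ‖a₂ γ * a₃ γ‖ = ‖a₂ γ‖ * ‖a₃ γ‖ := norm_mul _ _
    _ ≤ (C₂ * κ₂ γ ^ (-α)) * (C₃ * κ₃ γ ^ (-α)) :=
        mul_le_mul (h₂ γ) (h₃ γ) (norm_nonneg _) ((norm_nonneg _).trans (h₂ γ))
    _ ≤ (|C₂| * κ₂ γ ^ (-α)) * (|C₃| * κ₃ γ ^ (-α)) := by
        have hC2 : C₂ * κ₂ γ ^ (-α) ≤ |C₂| * κ₂ γ ^ (-α) :=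
          mul_le_mul_of_nonneg_right (le_abs_self C₂) hxα
        have hC3 : C₃ * κ₃ γ ^ (-α) ≤ |C₃| * κ₃ γ ^ (-α) :=
          mul_le_mul_of_nonneg_right (le_abs_self C₃) hyα
        exact mul_le_mul hC2 hC3 ((norm_nonneg _).trans (h₃ γ)) (by positivity)
    _ = (|C₂| * |C₃|) * (κ₂ γ ^ (-α) * κ₃ γ ^ (-α)) := by ring
    _ ≤ (|C₂| * |C₃|) * ((2 * M ^ 2) ^ α * (1 + (1 + |κ₂ γ - κ₀|) * (1 + |κ₃ γ - κ₀|)) ^ (-α)) :=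
        mul_le_mul_of_nonneg_left hkey (by positivity)
    _ = |C₂| * |C₃| * (2 * M ^ 2) ^ α * (1 + (1 + |κ₂ γ - κ₀|) * (1 + |κ₃ γ - κ₀|)) ^ (-α) := by ring

/-- **a bounded factor keeps the shape**: `‖a₁ γ‖ ≤ C₁` and `‖a γ‖ ≤ C (1 + size γ)^{−α}` give
`‖a₁ γ · a γ‖ ≤ C₁ C (1 + size γ)^{−α}`. -/
theorem a_bound_of_bounded_mul {Orb : Type*} (a₁ a : Orb → ℂ) (size : Orb → ℝ) (α : ℝ) {C₁ C : ℝ}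
    (h₁ : ∀ γ, ‖a₁ γ‖ ≤ C₁) (h : ∀ γ, ‖a γ‖ ≤ C * (1 + size γ) ^ (-α)) :
    ∀ γ, ‖a₁ γ * a γ‖ ≤ (C₁ * C) * (1 + size γ) ^ (-α) := by
  intro γ
  calc ‖a₁ γ * a γ‖ = ‖a₁ γ‖ * ‖a γ‖ := norm_mul _ _
    _ ≤ C₁ * (C * (1 + size γ) ^ (-α)) :=
        mul_le_mul (h₁ γ) (h γ) (norm_nonneg _) ((norm_nonneg _).trans (h₁ γ))
    _ = (C₁ * C) * (1 + size γ) ^ (-α) := by ring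

/-- the `∃ C` form of the previous lemma -/
theorem exists_a_bound_of_bounded_mul {Orb : Type*} (a₁ a : Orb → ℂ) (size : Orb → ℝ) (α : ℝ)
    (h₁ : ∃ C₁ : ℝ, ∀ γ, ‖a₁ γ‖ ≤ C₁)
    (h : ∃ C : ℝ, ∀ γ, ‖a γ‖ ≤ C * (1 + size γ) ^ (-α)) :
    ∃ C' : ℝ, ∀ γ, ‖a₁ γ * a γ‖ ≤ C' * (1 + size γ) ^ (-α) := by
  obtain ⟨C₁, h₁⟩ := h₁
  obtain ⟨C, h⟩ := h
  exact ⟨C₁ * C, a_bound_of_bounded_mul a₁ a size α h₁ h⟩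

end Summit.Ventures.HodgeRepro2.T7SupportArchDecayGlue
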